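import Summits.QuantumFields.BalabanUV.T4Continuum.Support.ShellMeasurePinnedProp4
import Summits.QuantumFields.BalabanUV.T4Continuum.Support.ShellMeasureMultiGridNormsMax

/-!
# `T4Continuum.ShellMeasurePinnedProp4Weighted` — S75 f2: PINNED `Prop4Hyp` FROM A LOCATED QUADRATIC MAJORANT IN THE
# WEIGHTED (`WMax`) CURRENCY — the pin on top of the level weights, so that the constant is η-FREE at the live levels
(cell `pub-balaban`, sub-cell `t4`, spine estimate NE7c (node U5b); owner lineage `b2b-balaban-t4-ne7c-p1`, gen 31,
row S75 file 2 of `t4/b2b-balaban-t4-ne7c-p1/LEAVES-NE7c-P1.md`, requested by the S77 holder leaf-02-g8 (journal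
l.17336: «S75's flat-sup base cannot host the live-level reading — the located majorant of the (39)-split action's
gradient is η-FREE only in the `WMax` currency»); ADDITIVE — imports S75 `ShellMeasurePinnedProp4` (p225698) and S65 f2c
`ShellMeasureMultiGridNormsMax` (p222450: `WMax w w′ Dv`) ONLY; [folklore]; 0 `def`, 0 `def … : Prop`, 0 sorry,
0 citations)

HONEST FRAMING.  Finite four-torus programme, rung (B)+1 only — NOT infinite volume, NOT a mass gap, NOT the Clay
problem, NOT summit progress; (B), `BetaPertHyp`, (B^μ) not consumed.  NE7c (`T4IndicatorShell.ShellWeightBound`) is NOT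
PRINTED in [Balaban 1983–89] and NOT PROVED; «NE7c ⇐ the named binders» (trigger c3).  Nothing printed is asserted;
no estimate of Bałaban's is discharged; functional-analytic PLUMBING on finite index sets.

THE POINT.  S75 `prop4Hyp_pinned` reads the nonlinearity `W` between FLAT sup spaces under the pin.  At a live level
the located quadratic majorant of the cell's typed action ((39)-split, S65 — `prop4Hyp_locGrad_ord₃_eta_levels`) is
η-free only in S65 f2c's currency `WMax wt wd Dv` (`max{|A′|_{(−1)}, |∇A′|_{(−2)}}`) with the OUTPUT weight `(wt c)³`
(`|·|_{(−3)}`): per S77 (leaf-02-g8), for `Y : WMax wt wd Dv` with `‖Y‖ < a₃`,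
`v₀ c·‖W (toPiL Y) c‖ ≤ ‖Y‖·Σ_b k c b·(wt b·‖Y b‖)` with an η-FREE located kernel `k`.  THIS FILE puts the PIN ON TOP
OF THE WEIGHTS: source `WMax (wt·e^{δ′ϖ∘pos}) wd Dv` (pin on the FIELD component; the ∇-datum unpinned — it enters only
through the global factor), target `WSup (v₀·e^{δ′ϖ∘pos′}) 1 𝔅`, and concludes `Prop4Hyp W_pin M a₃` with
`M ≥ Σ_b k c b·e^{δ′ρ(pos′ c, pos b)}` — the §2 chain of S75 with the weights carried along:
`e^{δ′ϖ c}·v₀ c·‖W A c‖ ≤ ‖Y‖·Σ_b k c b·e^{δ′ρ(c,b)}·(e^{δ′ϖ b}·wt b·‖A b‖) ≤ ‖Y‖·M·‖Y_pin‖ ≤ M·‖Y_pin‖²`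
(`‖Y‖_{WMax wt} ≤ ‖Y‖_{WMax (wt·pin)}` because the pin is `≥ 1` on the field component and absent on the ∇-component).
* §1 `instFactMulPinW`, `norm_field_le` (`e^{δ′ϖ b}·wt b·‖Y b‖ ≤ ‖Y‖_pin`), `norm_unpin_le` (`‖Y‖_{WMax wt} ≤ ‖Y‖_pin`);
* §2 **`pinned_quad_le_weighted`**; §3 **`prop4Hyp_pinned_weighted`** (+ differentiability transferred from the UNPINNED
  `WMax` ball through the identity maps); §4 non-vacuity toy.
LOCATED INPUTS (displayed, NOT discharged): the weighted located majorant `k` and its conjugated row sums (S77 supplies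
them for OUR typed action; for Bałaban's `(δ∕δA′)V` they are (98)∕(40) TYPE), flat analyticity on the `WMax` ball.
NOTHING in the countdown moves; NE7c NOT PROVED; spine PROVED 0∕9.  HONEST DEPENDENCY (cell): continuum YM on T⁴ ⇐
BetaPertH ∧ nine spine estimates (0/9 proved); BetaPertH ⇐ (D1) ∧ (D4) ∧ CAP+tail; G-an2-4 gates asym, D1 and NE2/3/4.
-/

noncomputable section

open Metric Set Function

namespace Summit.QuantumFields.BalabanUV.T4Continuum.ShellMeasurePinnedProp4Weighted

open Literature.MathematicalPhysics.QuantumFieldTheory.Balaban1983to89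
open B11Prop6Scheme (Prop4Hyp)
open Summit.QuantumFields.BalabanUV.T4Continuum.ShellMeasureMultiGridNorms (WSup)
open Summit.QuantumFields.BalabanUV.T4Continuum.ShellMeasureMultiGridNormsMax (WMax)
open Summit.QuantumFields.BalabanUV.T4Continuum.ShellMeasurePinnedNorm (pinW pinW_apply pinW_pos)

variable {Λ Λd Λ' : Type*} [Fintype Λ] [Fintype Λd] [Fintype Λ'] {𝔄 𝔇 𝔅 : Type*} [NormedAddCommGroup 𝔄]
  [NormedSpace ℂ 𝔄] [NormedAddCommGroup 𝔇] [NormedSpace ℂ 𝔇] [NormedAddCommGroup 𝔅] [NormedSpace ℂ 𝔅]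
variable {S : Type*}

/-! ## §1 The pin on top of the weights -/

/-- a positive weight times the pinned weight is positive (the `Fact` the weighted spaces ask for). [folklore] -/
instance instFactMulPinW (w : Λ → ℝ) [hw : Fact (∀ b, 0 < w b)] (δ' : ℝ) (ϖ : Λ → ℝ) :
    Fact (∀ b, 0 < w b * pinW δ' ϖ b) :=
  ⟨fun b => mul_pos (hw.out b) (pinW_pos δ' ϖ b)⟩

section Norms

variable (wt : Λ → ℝ) (wd : Λd → ℝ) (Dv : (Λ → 𝔄) →L[ℂ] (Λd → 𝔇)) [hwt : Fact (∀ b, 0 < wt b)]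
  [hwd : Fact (∀ b, 0 < wd b)] (δ' : ℝ) (ϖ : S → ℝ) (posIn : Λ → S)

/-- **THE PINNED FIELD COMPONENT IS BELOW THE PINNED `WMax` NORM**: `e^{δ′ϖ(pos b)}·wt b·‖Y b‖ ≤ ‖Y‖`. [folklore] -/
theorem norm_field_le (Y : WMax (fun b => wt b * pinW δ' (ϖ ∘ posIn) b) wd Dv) (b : Λ) :
    Real.exp (δ' * ϖ (posIn b)) * (wt b * ‖Y b‖) ≤ ‖Y‖ := by
  have h1 := WSup.norm_apply_le (fun b => wt b * pinW δ' (ϖ ∘ posIn) b) 1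
    (show WSup (fun b => wt b * pinW δ' (ϖ ∘ posIn) b) 1 𝔄 from Y) b
  have h2 := WMax.norm_wsup_le (fun b => wt b * pinW δ' (ϖ ∘ posIn) b) wd Dv Y
  rw [pow_one, pinW_apply, comp_apply] at h1
  calc Real.exp (δ' * ϖ (posIn b)) * (wt b * ‖Y b‖) = wt b * Real.exp (δ' * ϖ (posIn b)) * ‖Y b‖ := by ring
    _ ≤ _ := h1.trans h2

/-- **UNPINNING DOES NOT INCREASE THE NORM** (`δ′ ≥ 0`, `ϖ ≥ 0`): the same field read in `WMax wt wd Dv` has norm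
`≤` its pinned norm (the pin is `≥ 1` on the field component; the ∇-component is the same). [folklore] -/
theorem norm_unpin_le (hδ' : 0 ≤ δ') (hϖ0 : ∀ x, 0 ≤ ϖ x)
    (Y : WMax (fun b => wt b * pinW δ' (ϖ ∘ posIn) b) wd Dv) :
    ‖((WMax.toPiL wt wd Dv).symm (WMax.toPiL (fun b => wt b * pinW δ' (ϖ ∘ posIn) b) wd Dv Y) : WMax wt wd Dv)‖ ≤
      ‖Y‖ := by
  set Y₀ : WMax wt wd Dv := (WMax.toPiL wt wd Dv).symm (WMax.toPiL (fun b => wt b * pinW δ' (ϖ ∘ posIn) b) wd Dv Y)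
    with hY₀
  have hfun : ∀ b, Y₀ b = Y b := fun _ => rfl
  rw [WMax.norm_def wt wd Dv Y₀]
  refine max_le ?_ ?_
  · refine (WSup.norm_le_iff wt 1 (norm_nonneg Y)).2 fun b => ?_
    rw [pow_one]
    have h1 : (1 : ℝ) ≤ Real.exp (δ' * ϖ (posIn b)) := Real.one_le_exp (mul_nonneg hδ' (hϖ0 _))
    calc wt b * ‖(show WSup wt 1 𝔄 from Y₀) b‖ = 1 * (wt b * ‖Y b‖) := by rw [one_mul]; rfl
      _ ≤ Real.exp (δ' * ϖ (posIn b)) * (wt b * ‖Y b‖) :=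
          mul_le_mul_of_nonneg_right h1 (mul_nonneg (hwt.out b).le (norm_nonneg _))
      _ ≤ ‖Y‖ := norm_field_le wt wd Dv δ' ϖ posIn Y b
  · have h := WMax.norm_deriv_le (fun b => wt b * pinW δ' (ϖ ∘ posIn) b) wd Dv Y
    exact le_of_eq_of_le rfl h

end Norms

/-! ## §2 The pinned quadratic bound in the weighted currency -/

section Quad

variable (wt : Λ → ℝ) (wd : Λd → ℝ) (Dv : (Λ → 𝔄) →L[ℂ] (Λd → 𝔇)) [hwt : Fact (∀ b, 0 < wt b)]
  [hwd : Fact (∀ b, 0 < wd b)] (v₀ : Λ' → ℝ) [hv₀ : Fact (∀ c, 0 < v₀ c)]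

/-- **THE PINNED QUADRATIC BOUND, WEIGHTED.**  A flat nonlinear map `W : (Λ → 𝔄) → (Λ′ → 𝔅)` with a LOCATED QUADRATIC
MAJORANT IN THE `WMax` CURRENCY — for `Y : WMax wt wd Dv` with `‖Y‖ < a₃` and every `c`,
`v₀ c·‖W (toPiL Y) c‖ ≤ ‖Y‖·Σ_b k c b·(wt b·‖Y b‖)` (`k ≥ 0`) — and conjugated row sums `Σ_b k c b·e^{δ′ρ(pos′ c, pos b)} ≤ M`
(`M ≥ 0`; one-sided Lipschitz pin, `δ′ ≥ 0`, `ϖ ≥ 0`), read from the PINNED source `WMax (wt·e^{δ′ϖ∘pos}) wd Dv` to the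
PINNED target `WSup (v₀·e^{δ′ϖ∘pos′}) 1 𝔅`, satisfies `‖W_pin Y‖ ≤ M·‖Y‖²` on `‖Y‖_pin < a₃`. [folklore] -/
theorem pinned_quad_le_weighted (W : (Λ → 𝔄) → (Λ' → 𝔅)) (k : Λ' → Λ → ℝ) (ρ : S → S → ℝ) (posIn : Λ → S)
    (posOut : Λ' → S) (ϖ : S → ℝ) {δ' a₃ M : ℝ} (hδ' : 0 ≤ δ') (hϖ0 : ∀ x, 0 ≤ ϖ x)
    (hϖ : ∀ x y, ϖ x ≤ ϖ y + ρ x y) (hk : ∀ c b, 0 ≤ k c b)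
    (hquad : ∀ Y : WMax wt wd Dv, ‖Y‖ < a₃ → ∀ c,
      v₀ c * ‖W (WMax.toPiL wt wd Dv Y) c‖ ≤ ‖Y‖ * ∑ b, k c b * (wt b * ‖Y b‖))
    (hM0 : 0 ≤ M) (hM : ∀ c, ∑ b, k c b * Real.exp (δ' * ρ (posOut c) (posIn b)) ≤ M)
    (Y : WMax (fun b => wt b * pinW δ' (ϖ ∘ posIn) b) wd Dv) (hY : ‖Y‖ < a₃) :
    ‖((WSup.toPiL (fun c => v₀ c * pinW δ' (ϖ ∘ posOut) c) 1).symm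
        (W (WMax.toPiL (fun b => wt b * pinW δ' (ϖ ∘ posIn) b) wd Dv Y)) :
          WSup (fun c => v₀ c * pinW δ' (ϖ ∘ posOut) c) 1 𝔅)‖ ≤ M * ‖Y‖ ^ 2 := by
  -- the same field in the unpinned `WMax`
  set Y₀ : WMax wt wd Dv := (WMax.toPiL wt wd Dv).symm (WMax.toPiL (fun b => wt b * pinW δ' (ϖ ∘ posIn) b) wd Dv Y)
    with hY₀
  have hfun : WMax.toPiL wt wd Dv Y₀ = WMax.toPiL (fun b => wt b * pinW δ' (ϖ ∘ posIn) b) wd Dv Y := rfl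
  have hY₀b : ∀ b, Y₀ b = Y b := fun _ => rfl
  have hle : ‖Y₀‖ ≤ ‖Y‖ := norm_unpin_le wt wd Dv δ' ϖ posIn hδ' hϖ0 Y
  have hY₀a : ‖Y₀‖ < a₃ := hle.trans_lt hY
  have hYn : 0 ≤ ‖Y‖ := norm_nonneg _
  refine (WSup.norm_le_iff (fun c => v₀ c * pinW δ' (ϖ ∘ posOut) c) 1 (by positivity)).2 fun c => ?_
  rw [pow_one, WSup.toPiL_symm_apply, pinW_apply, comp_apply, ← hfun]
  -- the conjugated majorant
  have hq := hquad Y₀ hY₀a c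
  have h1 : v₀ c * Real.exp (δ' * ϖ (posOut c)) * ‖W (WMax.toPiL wt wd Dv Y₀) c‖ ≤
      ‖Y₀‖ * ∑ b, k c b * (Real.exp (δ' * ρ (posOut c) (posIn b)) * ‖Y‖) := by
    calc v₀ c * Real.exp (δ' * ϖ (posOut c)) * ‖W (WMax.toPiL wt wd Dv Y₀) c‖
        = Real.exp (δ' * ϖ (posOut c)) * (v₀ c * ‖W (WMax.toPiL wt wd Dv Y₀) c‖) := by ring
      _ ≤ Real.exp (δ' * ϖ (posOut c)) * (‖Y₀‖ * ∑ b, k c b * (wt b * ‖Y₀ b‖)) :=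
          mul_le_mul_of_nonneg_left hq (by positivity)
      _ = ‖Y₀‖ * ∑ b, k c b * (Real.exp (δ' * ϖ (posOut c)) * (wt b * ‖Y b‖)) := by
          rw [Finset.mul_sum, Finset.mul_sum, Finset.mul_sum]
          refine Finset.sum_congr rfl fun b _ => ?_; rw [hY₀b]; ring
      _ ≤ ‖Y₀‖ * ∑ b, k c b * (Real.exp (δ' * ρ (posOut c) (posIn b)) * ‖Y‖) := by
          refine mul_le_mul_of_nonneg_left (Finset.sum_le_sum fun b _ =>
            mul_le_mul_of_nonneg_left ?_ (hk c b)) (norm_nonneg _)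
          -- `e^{δ′ϖ c}·(wt b‖Y b‖) ≤ e^{δ′ρ(c,b)}·(e^{δ′ϖ b}·wt b‖Y b‖) ≤ e^{δ′ρ(c,b)}·‖Y‖_pin`
          have h2 : Real.exp (δ' * ϖ (posOut c)) ≤
              Real.exp (δ' * ρ (posOut c) (posIn b)) * Real.exp (δ' * ϖ (posIn b)) := by
            rw [← Real.exp_add]; exact Real.exp_le_exp.2 (by nlinarith [hϖ (posOut c) (posIn b)])
          have h3 := norm_field_le wt wd Dv δ' ϖ posIn Y b
          have h4 : 0 ≤ wt b * ‖Y b‖ := mul_nonneg (hwt.out b).le (norm_nonneg _)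
          calc Real.exp (δ' * ϖ (posOut c)) * (wt b * ‖Y b‖)
              ≤ (Real.exp (δ' * ρ (posOut c) (posIn b)) * Real.exp (δ' * ϖ (posIn b))) * (wt b * ‖Y b‖) :=
                mul_le_mul_of_nonneg_right h2 h4
            _ = Real.exp (δ' * ρ (posOut c) (posIn b)) * (Real.exp (δ' * ϖ (posIn b)) * (wt b * ‖Y b‖)) := by
                ring
            _ ≤ Real.exp (δ' * ρ (posOut c) (posIn b)) * ‖Y‖ := mul_le_mul_of_nonneg_left h3 (by positivity)
  have h2 : ∑ b, k c b * (Real.exp (δ' * ρ (posOut c) (posIn b)) * ‖Y‖) ≤ M * ‖Y‖ := by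
    have : ∑ b, k c b * (Real.exp (δ' * ρ (posOut c) (posIn b)) * ‖Y‖) =
        (∑ b, k c b * Real.exp (δ' * ρ (posOut c) (posIn b))) * ‖Y‖ := by
      rw [Finset.sum_mul]; refine Finset.sum_congr rfl fun b _ => ?_; ring
    rw [this]
    exact mul_le_mul_of_nonneg_right (hM c) hYn
  calc v₀ c * Real.exp (δ' * ϖ (posOut c)) * ‖W (WMax.toPiL wt wd Dv Y₀) c‖
      ≤ ‖Y₀‖ * ∑ b, k c b * (Real.exp (δ' * ρ (posOut c) (posIn b)) * ‖Y‖) := h1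
    _ ≤ ‖Y‖ * (M * ‖Y‖) := mul_le_mul hle h2 (Finset.sum_nonneg fun b _ => by
        have := hk c b; positivity) hYn
    _ = M * ‖Y‖ ^ 2 := by ring

end Quad

/-! ## §3 `Prop4Hyp` in the pinned weighted currency -/

section Prop4

variable (wt : Λ → ℝ) (wd : Λd → ℝ) (Dv : (Λ → 𝔄) →L[ℂ] (Λd → 𝔇)) [hwt : Fact (∀ b, 0 < wt b)]
  [hwd : Fact (∀ b, 0 < wd b)] (v₀ : Λ' → ℝ) [hv₀ : Fact (∀ c, 0 < v₀ c)]

/-- **PINNED `Prop4Hyp` IN THE WEIGHTED CURRENCY.**  Under the hypotheses of `pinned_quad_le_weighted` plus the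
differentiability of `W ∘ toPiL` on the UNPINNED ball `{Y : WMax wt wd Dv | ‖Y‖ < a₃}` (`a₃ > 0`; the clause of S65's
`Prop4Hyp`s), the map read from `WMax (wt·e^{δ′ϖ∘pos}) wd Dv` to `WSup (v₀·e^{δ′ϖ∘pos′}) 1 𝔅` satisfies
`B11Prop6Scheme.Prop4Hyp W_pin M a₃` LITERALLY — S70 f4's `hW` pinned, η-FREE when `k` is (S77 at live levels).
[folklore] -/
theorem prop4Hyp_pinned_weighted (W : (Λ → 𝔄) → (Λ' → 𝔅)) (k : Λ' → Λ → ℝ) (ρ : S → S → ℝ) (posIn : Λ → S)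
    (posOut : Λ' → S) (ϖ : S → ℝ) {δ' a₃ M : ℝ} (hδ' : 0 ≤ δ') (hϖ0 : ∀ x, 0 ≤ ϖ x)
    (hϖ : ∀ x y, ϖ x ≤ ϖ y + ρ x y) (hk : ∀ c b, 0 ≤ k c b)
    (hquad : ∀ Y : WMax wt wd Dv, ‖Y‖ < a₃ → ∀ c,
      v₀ c * ‖W (WMax.toPiL wt wd Dv Y) c‖ ≤ ‖Y‖ * ∑ b, k c b * (wt b * ‖Y b‖))
    (hM0 : 0 ≤ M) (hM : ∀ c, ∑ b, k c b * Real.exp (δ' * ρ (posOut c) (posIn b)) ≤ M)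
    (hWd : DifferentiableOn ℂ (fun Y : WMax wt wd Dv => W (WMax.toPiL wt wd Dv Y)) {Y | ‖Y‖ < a₃}) :
    Prop4Hyp (fun Y : WMax (fun b => wt b * pinW δ' (ϖ ∘ posIn) b) wd Dv =>
        ((WSup.toPiL (fun c => v₀ c * pinW δ' (ϖ ∘ posOut) c) 1).symm
          (W (WMax.toPiL (fun b => wt b * pinW δ' (ϖ ∘ posIn) b) wd Dv Y)) :
            WSup (fun c => v₀ c * pinW δ' (ϖ ∘ posOut) c) 1 𝔅)) M a₃ where
  quad Y hY := pinned_quad_le_weighted wt wd Dv v₀ W k ρ posIn posOut ϖ hδ' hϖ0 hϖ hk hquad hM0 hM Y hY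
  differentiableOn := by
    -- factor through the unpinned `WMax` by the identity maps (continuous linear equivalences)
    set ι : WMax (fun b => wt b * pinW δ' (ϖ ∘ posIn) b) wd Dv → WMax wt wd Dv :=
      fun Y => (WMax.toPiL wt wd Dv).symm (WMax.toPiL (fun b => wt b * pinW δ' (ϖ ∘ posIn) b) wd Dv Y) with hι
    have hιd : Differentiable ℂ ι :=
      (WMax.toPiL wt wd Dv).symm.differentiable.comp
        (WMax.toPiL (fun b => wt b * pinW δ' (ϖ ∘ posIn) b) wd Dv).differentiable
    have hmaps : MapsTo ι {Y | ‖Y‖ < a₃} {Y : WMax wt wd Dv | ‖Y‖ < a₃} := fun Y hY =>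
      (norm_unpin_le wt wd Dv δ' ϖ posIn hδ' hϖ0 Y).trans_lt hY
    have hcomp : DifferentiableOn ℂ (fun Y => W (WMax.toPiL wt wd Dv (ι Y))) {Y | ‖Y‖ < a₃} :=
      hWd.comp hιd.differentiableOn hmaps
    have e : (fun Y : WMax (fun b => wt b * pinW δ' (ϖ ∘ posIn) b) wd Dv =>
        ((WSup.toPiL (fun c => v₀ c * pinW δ' (ϖ ∘ posOut) c) 1).symm
          (W (WMax.toPiL (fun b => wt b * pinW δ' (ϖ ∘ posIn) b) wd Dv Y)) :
            WSup (fun c => v₀ c * pinW δ' (ϖ ∘ posOut) c) 1 𝔅)) =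
        (WSup.toPiL (fun c => v₀ c * pinW δ' (ϖ ∘ posOut) c) 1).symm ∘
          (fun Y => W (WMax.toPiL wt wd Dv (ι Y))) := rfl
    rw [e]
    exact (WSup.toPiL (𝔄 := 𝔅) (fun c => v₀ c * pinW δ' (ϖ ∘ posOut) c) 1).symm.differentiable.comp_differentiableOn
      hcomp

end Prop4

/-! ## §4 Non-vacuity -/

section Toy

/-- unit weights are positive (toy instance). [folklore] -/
instance instFactUnitWeight : Fact (∀ _ : Unit, (0 : ℝ) < (fun _ : Unit => (1 : ℝ)) ()) := ⟨fun _ => one_pos⟩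

/-- NON-VACUITY (trigger c3): the ZERO map with the zero majorant on one-point index sets, unit weights, `Dv = 0`
(`M = 0`, `a₃ = 1`, pin `ϖ ≡ 0`, `ρ ≡ 0`). [folklore] -/
example :
    Prop4Hyp (fun Y : WMax (fun b : Unit => (fun _ : Unit => (1 : ℝ)) b *
          pinW (0 : ℝ) ((fun _ : Unit => (0 : ℝ)) ∘ fun _ : Unit => ()) b)
        (fun _ : Unit => (1 : ℝ)) (0 : (Unit → ℂ) →L[ℂ] (Unit → ℂ)) =>
      ((WSup.toPiL (fun c : Unit => (fun _ : Unit => (1 : ℝ)) c *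
            pinW (0 : ℝ) ((fun _ : Unit => (0 : ℝ)) ∘ fun _ : Unit => ()) c) 1).symm
        ((fun _ : Unit → ℂ => (0 : Unit → ℂ))
          (WMax.toPiL (fun b : Unit => (fun _ : Unit => (1 : ℝ)) b *
              pinW (0 : ℝ) ((fun _ : Unit => (0 : ℝ)) ∘ fun _ : Unit => ()) b)
            (fun _ : Unit => (1 : ℝ)) (0 : (Unit → ℂ) →L[ℂ] (Unit → ℂ)) Y)) :
        WSup (fun c : Unit => (fun _ : Unit => (1 : ℝ)) c *
          pinW (0 : ℝ) ((fun _ : Unit => (0 : ℝ)) ∘ fun _ : Unit => ()) c) 1 ℂ))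
      0 1 :=
  prop4Hyp_pinned_weighted (S := Unit) (fun _ : Unit => (1 : ℝ)) (fun _ : Unit => (1 : ℝ))
    (0 : (Unit → ℂ) →L[ℂ] (Unit → ℂ)) (fun _ : Unit => (1 : ℝ)) (fun _ => 0) (fun _ _ => 0) (fun _ _ => 0)
    (fun _ => ()) (fun _ => ()) (fun _ => 0) le_rfl (fun _ => le_rfl) (fun _ _ => by simp) (fun _ _ => le_rfl)
    (fun Y _ c => by
      have h0 : (1 : ℝ) * ‖(fun _ : Unit → ℂ => (0 : Unit → ℂ))
          (WMax.toPiL (fun b : Unit => (fun _ : Unit => (1 : ℝ)) b) (fun _ : Unit => (1 : ℝ))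
            (0 : (Unit → ℂ) →L[ℂ] (Unit → ℂ)) Y) c‖ = 0 := by
        rw [one_mul]; exact norm_zero
      rw [h0]
      exact mul_nonneg (norm_nonneg _) (Finset.sum_nonneg fun b _ =>
        mul_nonneg le_rfl (mul_nonneg zero_le_one (norm_nonneg _))))
    le_rfl (fun c => by simp) (differentiableOn_const (0 : Unit → ℂ))

end Toy


end Summit.QuantumFields.BalabanUV.T4Continuum.ShellMeasurePinnedProp4Weighted

end
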